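import Summits.ResolutionOfSingularities.ResolutionOfSingularities.Theorems.FrobeniusLadderFRationalResolutionTowerStep
import Mathlib.Algebra.MonoidAlgebra.Basic
import Mathlib.RingTheory.FiniteType
import HarnessLib

/-!
# Toric surface programme: the `x`-chart of `Bl_{(x,xy)} U(r,a)` is an affine plane

Support file for crux stmt-ResolutionOfSingularities-15317 (`FrobeniusLadder.FRationalResolution`),
line `redirect`, lead c4 (toric surface programme for rung 4′: all affine toric surfaces
`U(r,a) = Spec k[{m ∈ ℤ² : 0 ≤ m₂, a m₂ ≤ r m₁}]` over every field are resolved by the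
Hirzebruch–Jung tower of two-chart monomial blow-ups). Stub `stub_toric_xChart_isRegularRing`.
Let `R = k[σ∨ ∩ ℤ²] ⊆ k[ℤ²]` be the toric surface algebra of `σ = cone((0,1),(r,-a))`, `1 ≤ r`,
and `x = χ^(1,0)`, `xy = χ^(1,1) ∈ R`. The `x`-chart of the blow-up of `I = (xy, x, x) = (x, xy)`
is the affine blowup algebra `R[I/x] ⊆ R[1/x]` (`blowupAlgebra`, image model of
`AffineBlowupAlgebra.lean`), and it is the affine plane `k[x, y]`, `y = xy/x`: the parametrisation
`ψ : k[X, Y] → R[I/x]`, `X ↦ x`, `Y ↦ xy/x`, is a ring isomorphism.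

* `toricXChart_mem_of_mem_blowupAlgebra` — a subring of `R[1/x]` containing `R` and `xy/x`
  contains `R[I/x]` (generated over `R` by the `i/x`, `i ∈ I`, and `i/x` is `R`-linear in `i`);
* `toricXChart_monomial_mul_pow` — the monomial identity `χ^(n₁,n₂) · x^{n₂} = x^{n₁} · (xy)^{n₂}`
  in `R`;
* `toricXChart_algebraMap_mem` — a subring of `R[1/x]` containing `k`, `x` and `xy/x` contains
  `R`: `R` is generated over `k` by the `χ^m`, `m ∈ σ∨ ∩ ℤ² ⊆ ℕ²` (`0 ≤ m₂`, `a m₂ ≤ r m₁` and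
  `r ≥ 1` force `0 ≤ m₁`), and `χ^(n₁,n₂) = x^{n₁} (xy/x)^{n₂}` in `R[1/x]`; so `ψ` is SURJECTIVE;
* `toricXChart_injective` — `ψ` is INJECTIVE: `x = χ^(1,0)` is a unit of `k[ℤ²]`, so the
  inclusion `R ⊆ k[ℤ²]` extends to `R[1/x] → k[ℤ²]` (`IsLocalization.Away.lift`), and composed
  with `ψ` it is the embedding `k[ℕ²] ↪ k[ℤ²]` (`AddMonoidAlgebra.mapDomain` along `ℕ² ↪ ℤ²`);
* `stub_toric_xChart_isRegularRing` — transport of Mathlib's instance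
  `IsRegularRing (MvPolynomial (Fin 2) k)` along `RingEquiv.ofBijective ψ`
  (`IsRegularRing.of_ringEquiv`).

All folklore (Fulton, *Introduction to toric varieties*, §2.6; Cox–Little–Schenck, *Toric
varieties*, §10.1); only Mathlib's localization / `MvPolynomial` / `AddMonoidAlgebra` API and
the tree's `div_mem_blowupAlgebra` are used; no named facts. The hypothesis `har : a ≤ r` of the
registered signature is not needed.
-/

set_option linter.dupNamespace false

noncomputable section

namespace Summit.ResolutionOfSingularities.ResolutionOfSingularities.Theorems.FRationalResolution

open CategoryTheory AlgebraicGeometry TopologicalSpace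
open Literature.AlgebraicGeometry.Resolution

section Toric

variable (k : Type) [Field k]

/-- The Laurent polynomial ring `k[ℤ²]` (coordinate ring of the 2-torus). -/
local notation3 "Lk" => AddMonoidAlgebra k (ℤ × ℤ)

/-- The lattice points of the dual cone `σ∨ = {m₂ ≥ 0, a m₂ ≤ r m₁}` of `σ = cone((0,1),(r,-a))`. -/
local notation3 "σS[" r ", " a "]" =>
  {m : ℤ × ℤ | 0 ≤ m.2 ∧ ((a : ℕ) : ℤ) * m.2 ≤ ((r : ℕ) : ℤ) * m.1}

/-- The toric surface algebra `k[σ∨ ∩ ℤ²] ⊆ k[ℤ²]`. -/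
local notation3 "TA[" r ", " a "]" =>
  Algebra.adjoin k ((fun m : ℤ × ℤ => AddMonoidAlgebra.single m (1 : k)) '' σS[r, a])

/-- **Generation of `R[I/x]`, `I = (xy, x, x)`**: a subring `T ⊆ R[1/x]` containing the image of
`R` and the fraction `xy/x` contains the affine blowup algebra `R[I/x]`. Indeed `R[I/x]` is
generated over `R` by the `i/x`, `i ∈ I`; the map `i ↦ i/x` is `R`-linear, and on the generators
of `I` its values `xy/x`, `x/x = 1` lie in `T`. [folklore] -/
theorem toricXChart_mem_of_mem_blowupAlgebra {R : Type*} [CommRing R] {x xy : R}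
    (T : Subring (Localization.Away x))
    (hR : ∀ s, algebraMap R (Localization.Away x) s ∈ T)
    (h₁ : algebraMap R (Localization.Away x) xy * IsLocalization.Away.invSelf x ∈ T)
    {w : Localization.Away x} (hw : w ∈ blowupAlgebra (Ideal.span {xy, x, x}) x) : w ∈ T := by
  induction hw using Algebra.adjoin_induction with
  | mem w hw =>
    obtain ⟨i, hi, rfl⟩ := hw
    induction hi using Submodule.span_induction with
    | mem i hi =>
      rcases hi with rfl | rfl | rfl
      · exact h₁
      · rw [IsLocalization.Away.mul_invSelf]
        exact T.one_mem
      · rw [IsLocalization.Away.mul_invSelf]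
        exact T.one_mem
    | zero =>
      rw [map_zero, zero_mul]
      exact T.zero_mem
    | add i j _ _ hi hj =>
      rw [map_add, add_mul]
      exact T.add_mem hi hj
    | smul c i _ hi =>
      rw [smul_eq_mul, map_mul, mul_assoc]
      exact T.mul_mem (hR c) hi
  | algebraMap s => exact hR s
  | add w₁ w₂ _ _ hw₁ hw₂ => exact T.add_mem hw₁ hw₂
  | mul w₁ w₂ _ _ hw₁ hw₂ => exact T.mul_mem hw₁ hw₂

/-- **The monomial identity** `χ^(n₁,n₂) · x^{n₂} = x^{n₁} · (xy)^{n₂}` in the toric algebra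
`R = k[σ∨ ∩ ℤ²]`, for `x = χ^(1,0)`, `xy = χ^(1,1)` (both sides are `χ^(n₁+n₂, n₂)` in `k[ℤ²]`).
[folklore] -/
theorem toricXChart_monomial_mul_pow (r a : ℕ) (x xy : ↥TA[r, a])
    (hx : (x : Lk) = AddMonoidAlgebra.single ((1 : ℤ), (0 : ℤ)) 1)
    (hxy : (xy : Lk) = AddMonoidAlgebra.single ((1 : ℤ), (1 : ℤ)) 1) (n₁ n₂ : ℕ)
    (h : AddMonoidAlgebra.single (((n₁ : ℕ) : ℤ), ((n₂ : ℕ) : ℤ)) (1 : k) ∈ TA[r, a]) :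
    (⟨AddMonoidAlgebra.single (((n₁ : ℕ) : ℤ), ((n₂ : ℕ) : ℤ)) (1 : k), h⟩ : ↥TA[r, a]) * x ^ n₂ =
      x ^ n₁ * xy ^ n₂ := by
  apply Subtype.ext
  change AddMonoidAlgebra.single (((n₁ : ℕ) : ℤ), ((n₂ : ℕ) : ℤ)) (1 : k) *
      ((x ^ n₂ : ↥TA[r, a]) : Lk) = ((x ^ n₁ : ↥TA[r, a]) : Lk) * ((xy ^ n₂ : ↥TA[r, a]) : Lk)
  rw [Subalgebra.coe_pow, Subalgebra.coe_pow, Subalgebra.coe_pow, hx, hxy,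
    AddMonoidAlgebra.single_pow, AddMonoidAlgebra.single_pow, AddMonoidAlgebra.single_pow,
    AddMonoidAlgebra.single_mul_single, AddMonoidAlgebra.single_mul_single]
  simp only [one_pow, mul_one]
  congr 1
  ext <;> simp

/-- **The image of `R` is reached**: for `R = k[σ∨ ∩ ℤ²]` (`1 ≤ r`), a subring `T ⊆ R[1/x]`
containing the image of `k`, the element `x = χ^(1,0)` and the fraction `y = xy/x`
(`xy = χ^(1,1)`) contains the image of `R`: `R` is generated over `k` by the monomials `χ^m`,
`m ∈ σ∨ ∩ ℤ²`, such `m` have `0 ≤ m₁, m₂` (`0 ≤ a m₂ ≤ r m₁` with `r ≥ 1`), and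
`χ^(n₁,n₂) = x^{n₁} · y^{n₂}` in `R[1/x]`. [folklore] -/
theorem toricXChart_algebraMap_mem (r a : ℕ) (hr : 1 ≤ r) (x xy : ↥TA[r, a])
    (hx : (x : Lk) = AddMonoidAlgebra.single ((1 : ℤ), (0 : ℤ)) 1)
    (hxy : (xy : Lk) = AddMonoidAlgebra.single ((1 : ℤ), (1 : ℤ)) 1)
    (T : Subring (Localization.Away x))
    (hC : ∀ c : k,
      algebraMap (↥TA[r, a]) (Localization.Away x) (algebraMap k (↥TA[r, a]) c) ∈ T)
    (h₀ : algebraMap (↥TA[r, a]) (Localization.Away x) x ∈ T)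
    (h₁ : algebraMap (↥TA[r, a]) (Localization.Away x) xy * IsLocalization.Away.invSelf x ∈ T)
    (s : ↥TA[r, a]) : algebraMap (↥TA[r, a]) (Localization.Away x) s ∈ T := by
  obtain ⟨s, hs⟩ := s
  induction hs using Algebra.adjoin_induction with
  | mem s hs =>
    obtain ⟨⟨m₁, m₂⟩, ⟨hm₂, hm⟩, rfl⟩ := hs
    -- `m ∈ σ∨ ∩ ℤ²` has nonnegative coordinates
    have hm₁ : 0 ≤ m₁ := by
      by_contra hneg
      have h1 : ((r : ℕ) : ℤ) * m₁ < 0 :=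
        mul_neg_of_pos_of_neg (by exact_mod_cast hr) (not_le.mp hneg)
      have h2 : 0 ≤ ((a : ℕ) : ℤ) * m₂ := mul_nonneg (Int.natCast_nonneg a) hm₂
      exact absurd (hm.trans_lt h1) (not_lt.mpr h2)
    obtain ⟨n₁, rfl⟩ := Int.eq_ofNat_of_zero_le hm₁
    obtain ⟨n₂, rfl⟩ := Int.eq_ofNat_of_zero_le hm₂
    -- `χ^(n₁,n₂) = x^{n₁} (xy/x)^{n₂}` in `R[1/x]`
    generalize_proofs hmem
    have key := toricXChart_monomial_mul_pow k r a x xy hx hxy n₁ n₂ hmem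
    have hinv :
        algebraMap (↥TA[r, a]) (Localization.Away x) x * IsLocalization.Away.invSelf x = 1 :=
      IsLocalization.Away.mul_invSelf x
    have hfrac : algebraMap (↥TA[r, a]) (Localization.Away x)
        ⟨AddMonoidAlgebra.single (((n₁ : ℕ) : ℤ), ((n₂ : ℕ) : ℤ)) (1 : k), hmem⟩ =
        algebraMap (↥TA[r, a]) (Localization.Away x) x ^ n₁ *
          (algebraMap (↥TA[r, a]) (Localization.Away x) xy *
            IsLocalization.Away.invSelf x) ^ n₂ := by
      calc algebraMap (↥TA[r, a]) (Localization.Away x)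
            ⟨AddMonoidAlgebra.single (((n₁ : ℕ) : ℤ), ((n₂ : ℕ) : ℤ)) (1 : k), hmem⟩
          = algebraMap (↥TA[r, a]) (Localization.Away x)
              ⟨AddMonoidAlgebra.single (((n₁ : ℕ) : ℤ), ((n₂ : ℕ) : ℤ)) (1 : k), hmem⟩ *
              (algebraMap (↥TA[r, a]) (Localization.Away x) x *
                IsLocalization.Away.invSelf x) ^ n₂ := by
            rw [hinv, one_pow, mul_one]
        _ = algebraMap (↥TA[r, a]) (Localization.Away x)
              ((⟨AddMonoidAlgebra.single (((n₁ : ℕ) : ℤ), ((n₂ : ℕ) : ℤ)) (1 : k), hmem⟩ :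
                ↥TA[r, a]) * x ^ n₂) * IsLocalization.Away.invSelf x ^ n₂ := by
            rw [map_mul, map_pow, mul_pow, mul_assoc]
        _ = algebraMap (↥TA[r, a]) (Localization.Away x) x ^ n₁ *
              (algebraMap (↥TA[r, a]) (Localization.Away x) xy *
                IsLocalization.Away.invSelf x) ^ n₂ := by
            rw [key, map_mul, map_pow, map_pow, mul_pow, mul_assoc]
    rw [hfrac]
    exact T.mul_mem (T.pow_mem h₀ n₁) (T.pow_mem h₁ n₂)
  | algebraMap c => exact hC c
  | add s t _ _ hs ht =>
    have hst := T.add_mem hs ht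
    rwa [← map_add] at hst
  | mul s t _ _ hs ht =>
    have hst := T.mul_mem hs ht
    rwa [← map_mul] at hst

/-- **Injectivity by the torus embedding.** Let `φ : k[X, Y] → R[1/x]` be a ring map with
`φ c = c`, `φ X = x`, `φ Y = xy/x` (`R = k[σ∨ ∩ ℤ²]`, `x = χ^(1,0)`, `xy = χ^(1,1)`). Then `φ` is
injective: `x` is a unit of `k[ℤ²]` (inverse `χ^(-1,0)`), so the inclusion `R ⊆ k[ℤ²]` extends
to `λ : R[1/x] → k[ℤ²]` (`IsLocalization.Away.lift`) with `λ (xy/x) = χ^(0,1)`; hence `λ ∘ φ` is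
the embedding `k[ℕ²] ↪ k[ℤ²]`, `X ↦ χ^(1,0)`, `Y ↦ χ^(0,1)` (`AddMonoidAlgebra.mapDomain` along
the injection `(e₀, e₁) ↦ (e₀, e₁) : ℕ² → ℤ²`), which is injective. [folklore] -/
theorem toricXChart_injective (r a : ℕ) (x xy : ↥TA[r, a])
    (hx : (x : Lk) = AddMonoidAlgebra.single ((1 : ℤ), (0 : ℤ)) 1)
    (hxy : (xy : Lk) = AddMonoidAlgebra.single ((1 : ℤ), (1 : ℤ)) 1)
    (φ : MvPolynomial (Fin 2) k →+* Localization.Away x)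
    (hφC : ∀ c, φ (MvPolynomial.C c) =
      algebraMap (↥TA[r, a]) (Localization.Away x) (algebraMap k (↥TA[r, a]) c))
    (hφ0 : φ (MvPolynomial.X 0) = algebraMap (↥TA[r, a]) (Localization.Away x) x)
    (hφ1 : φ (MvPolynomial.X 1) =
      algebraMap (↥TA[r, a]) (Localization.Away x) xy * IsLocalization.Away.invSelf x) :
    Function.Injective φ := by
  -- `x = χ^(1,0)` is a unit of `k[ℤ²]`, so the inclusion extends to `R[1/x] → k[ℤ²]`
  have hunit : IsUnit (algebraMap (↥TA[r, a]) Lk x) := by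
    rw [Subalgebra.algebraMap_apply, hx]
    refine IsUnit.of_mul_eq_one (AddMonoidAlgebra.single ((-1 : ℤ), (0 : ℤ)) (1 : k)) ?_
    rw [AddMonoidAlgebra.single_mul_single, mul_one, AddMonoidAlgebra.one_def]
    congr 1
  have hlift : ∀ s : ↥TA[r, a], IsLocalization.Away.lift (S := Localization.Away x) x hunit
      (algebraMap (↥TA[r, a]) (Localization.Away x) s) = (s : Lk) :=
    fun s => IsLocalization.Away.lift_eq x hunit s
  have hinv : (x : Lk) * IsLocalization.Away.lift (S := Localization.Away x) x hunit
      (IsLocalization.Away.invSelf x) = 1 := by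
    rw [← hlift x, ← map_mul, IsLocalization.Away.mul_invSelf, map_one]
  have h11 : AddMonoidAlgebra.single ((1 : ℤ), (1 : ℤ)) (1 : k) =
      AddMonoidAlgebra.single ((0 : ℤ), (1 : ℤ)) (1 : k) * (x : Lk) := by
    rw [hx, AddMonoidAlgebra.single_mul_single, mul_one]
    congr 1
  -- the injection `ℕ² ↪ ℤ²` on exponents
  let ι : (Fin 2 →₀ ℕ) →+ ℤ × ℤ :=
    { toFun := fun e => (((e 0 : ℕ) : ℤ), ((e 1 : ℕ) : ℤ))
      map_zero' := by simp
      map_add' := fun e e' => by simp }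
  have hι : Function.Injective ι := by
    intro e e' h
    simp only [ι, AddMonoidHom.coe_mk, ZeroHom.coe_mk, Prod.mk.injEq, Nat.cast_inj] at h
    ext i
    fin_cases i
    · exact h.1
    · exact h.2
  -- the extension composed with `φ` is `mapDomain ι`
  have hcomp : (IsLocalization.Away.lift (S := Localization.Away x) x hunit).comp φ =
      AddMonoidAlgebra.mapDomainRingHom k ι := by
    refine MvPolynomial.ringHom_ext (fun c => ?_) (fun i => ?_)
    · rw [RingHom.comp_apply, hφC, hlift, Subalgebra.coe_algebraMap,
        AddMonoidAlgebra.mapDomainRingHom_apply, MvPolynomial.C_apply,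
        ← MvPolynomial.single_eq_monomial, AddMonoidAlgebra.mapDomain_single, map_zero,
        AddMonoidAlgebra.coe_algebraMap, Function.comp_apply, Algebra.algebraMap_self_apply]
    · match i with
      | 0 =>
        rw [RingHom.comp_apply, hφ0, hlift, hx, AddMonoidAlgebra.mapDomainRingHom_apply,
          MvPolynomial.X, ← MvPolynomial.single_eq_monomial, AddMonoidAlgebra.mapDomain_single]
        congr 1
        simp [ι]
      | 1 =>
        rw [RingHom.comp_apply, hφ1, map_mul, hlift, hxy, h11, mul_assoc, hinv, mul_one,
          AddMonoidAlgebra.mapDomainRingHom_apply, MvPolynomial.X,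
          ← MvPolynomial.single_eq_monomial, AddMonoidAlgebra.mapDomain_single]
        congr 1
        simp [ι]
  refine Function.Injective.of_comp
    (f := IsLocalization.Away.lift (S := Localization.Away x) x hunit) ?_
  rw [← RingHom.coe_comp, hcomp]
  exact AddMonoidAlgebra.mapDomain_injective hι

/-- **THE `x`-CHART OF `Bl_{(x,xy)} U(r,a)` IS AN AFFINE PLANE** (registered stub
`stub_toric_xChart_isRegularRing`, crux stmt-ResolutionOfSingularities-15317, line `redirect`).
For the toric surface algebra `R = k[σ∨ ∩ ℤ²]`, `σ = cone((0,1),(r,-a))`, `1 ≤ r`, with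
`x = χ^(1,0)`, `xy = χ^(1,1) ∈ R`, the affine blowup algebra `R[I/x] ⊆ R[1/x]` of
`I = (xy, x, x) = (x, xy)` is a regular ring: the parametrisation `k[X, Y] → R[I/x]`, `X ↦ x`,
`Y ↦ xy/x`, is surjective (`toricXChart_mem_of_mem_blowupAlgebra`, `toricXChart_algebraMap_mem`)
and injective (`toricXChart_injective`), and `k[X, Y]` is regular (Mathlib), transported along
`IsRegularRing.of_ringEquiv`. The hypothesis `har : a ≤ r` is not needed. [folklore] -/
theorem stub_toric_xChart_isRegularRing (r a : ℕ) (hr : 1 ≤ r) (har : a ≤ r) (x xy : ↥TA[r, a])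
    (hx : (x : Lk) = AddMonoidAlgebra.single ((1 : ℤ), (0 : ℤ)) 1)
    (hxy : (xy : Lk) = AddMonoidAlgebra.single ((1 : ℤ), (1 : ℤ)) 1) :
    IsRegularRing ↥(blowupAlgebra (Ideal.span {xy, x, x}) x) := by
  -- `a ≤ r` is part of the registered signature but not used: recorded
  have _ := har
  have hxyI : xy ∈ Ideal.span {xy, x, x} := Ideal.subset_span (by simp)
  -- the chart parametrisation `ψ : k[X, Y] → R[I/x]`, `X ↦ x`, `Y ↦ xy/x`
  let ψ : MvPolynomial (Fin 2) k →+* ↥(blowupAlgebra (Ideal.span {xy, x, x}) x) :=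
    MvPolynomial.eval₂Hom ((algebraMap (↥TA[r, a]) _).comp (algebraMap k (↥TA[r, a])))
      ![algebraMap (↥TA[r, a]) _ x, ⟨_, div_mem_blowupAlgebra _ x hxyI⟩]
  -- followed by the inclusion `R[I/x] ⊆ R[1/x]`
  let φ : MvPolynomial (Fin 2) k →+* Localization.Away x :=
    (blowupAlgebra (Ideal.span {xy, x, x}) x).val.toRingHom.comp ψ
  have hφ : ∀ p, φ p = (ψ p : Localization.Away x) := fun p => rfl
  have hφC : ∀ c, φ (MvPolynomial.C c) =
      algebraMap (↥TA[r, a]) (Localization.Away x) (algebraMap k (↥TA[r, a]) c) := by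
    intro c
    rw [hφ]
    simp only [ψ, MvPolynomial.coe_eval₂Hom, MvPolynomial.eval₂_C, RingHom.comp_apply]
    rfl
  have hφ0 : φ (MvPolynomial.X 0) = algebraMap (↥TA[r, a]) (Localization.Away x) x := by
    rw [hφ]
    simp only [ψ, MvPolynomial.coe_eval₂Hom, MvPolynomial.eval₂_X, Matrix.cons_val_zero]
    rfl
  have hφ1 : φ (MvPolynomial.X 1) =
      algebraMap (↥TA[r, a]) (Localization.Away x) xy * IsLocalization.Away.invSelf x := by
    rw [hφ]
    simp only [ψ, MvPolynomial.coe_eval₂Hom, MvPolynomial.eval₂_X, Matrix.cons_val_one,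
      Matrix.cons_val_zero]
  -- `ψ` is injective (torus embedding) and surjective (generation)
  have hinj : Function.Injective ψ :=
    Function.Injective.of_comp (f := (blowupAlgebra (Ideal.span {xy, x, x}) x).val.toRingHom)
      (toricXChart_injective k r a x xy hx hxy φ hφC hφ0 hφ1)
  have hsurj : Function.Surjective ψ := by
    intro b
    have hR : ∀ s, algebraMap (↥TA[r, a]) (Localization.Away x) s ∈ φ.range :=
      toricXChart_algebraMap_mem k r a hr x xy hx hxy φ.range (fun c => ⟨_, hφC c⟩) ⟨_, hφ0⟩
        ⟨_, hφ1⟩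
    obtain ⟨p, hp⟩ : (b : Localization.Away x) ∈ φ.range :=
      toricXChart_mem_of_mem_blowupAlgebra φ.range hR ⟨_, hφ1⟩ b.2
    exact ⟨p, Subtype.ext hp⟩
  -- transport regularity of `k[X, Y]` along the ring isomorphism `ψ`
  exact IsRegularRing.of_ringEquiv (RingEquiv.ofBijective ψ ⟨hinj, hsurj⟩)

end Toric

end Summit.ResolutionOfSingularities.ResolutionOfSingularities.Theorems.FRationalResolution

end
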